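import Summits.ValiantsHypothesis.ValiantsHypothesis.Theorems.KPlusLogSqLawTropicalBRegisterPairGadget


/-!
# Route «KPlusLogSqLaw», crux `TropicalB` (stmt-ValiantsHypothesis-19771) — THE REGISTER-PAIR LAW, part 2 (the law):
# two SAME-SIDE registers read by a common matching gadget cannot couple their digits (no 3 × 3 product of dominant terms)

HONEST FRAMING.  Helper toward the registered stubs `stub_tropThin` / `stub_tropFat` of `Cruxes/TropicalB/Lines/birth.lean` (crux
`Summit.ValiantsHypothesis.ValiantsHypothesis.Theses.KPlusLogSqLaw.TropicalB`, item stmt-ValiantsHypothesis-19771, route KPlusLogSqLaw;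
cell `pub-symmetroid`, seat val-sym-trop-p4 g11, 2026-08-27; `--supports … --as helper`).  A STRUCTURE (no-go) theorem about finite
families of unique optima (`IsDominant`) of an ARBITRARY dominance design; it kills one architecture class for the cell's `K = 4`
«third digit» question and says nothing about `TropicalB` in its window, `WeakLifting`, DoorA26 / DoorA34, `MatrixDescartes`
(stmt-ValiantsHypothesis-18050) or VP ≠ VNP.

THE LAW (`registerPair_law`).  Fix a set `G` of columns (the GADGET), a set `N` of rows (its interior) and one class `l₀`.  Suppose nine
terms `u a b` (`a, b : Fin 3`) are each the unique optimum of the design at some integer slope `θ a b`, increasing in `a` and in `b`, and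
 (i)  on the gadget columns every `u a b` uses class `l₀` and its rows there are exactly `N ∪ {rI a, rJ b}` — the gadget absorbs ONE exposed
      row `rI a` of a first register and ONE exposed row `rJ b` of a second register (both registers expose ROWS: «same side»);
 (ii) off the gadget, every column of `u a b` depends on `a` alone or on `b` alone (registers, spectators).
Then `False`: no design carries such a family.  So a `K = 4` «three-digit» machine built from hole registers two of which expose holes on
the same side of the matrix, read by ANY coupling gadget of one class, hosts at most a `3 × 2` / `2 × 3` product of two of its digits —
whatever the third register, the exponents, the valuations and the gadget.  (Opposite-side pairs DO couple: the cell's `K = 3` COUPLED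
REGISTER (…TropicalBCoupledRegisters) reads a row hole against a column hole through one cell and realises the full `(N+1)²` product.)

WHY (the proof; part 1 = …TropicalBRegisterPairGadget).  (1) PARALLELOGRAM LAW (`RegisterPair.parallelogram`, part 1): four dominant/present terms with slopes `S_A + S_D = S_B + S_C`, `S_A < S_B`,
`S_A < S_C` have valuation sums `V_B + V_C < V_A + V_D` (convexity of the hull).  With (ii) the off-gadget parts are modular on every
`2 × 2` minor, so the GADGET VALUES `VG a b = Σ_{g ∈ G} v (u a b g) g l₀` are STRICTLY SUPERMODULAR in `(a, b)`.  (2) By dominance each gadget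
part is the cheapest matching of `G` into its row set (`RegisterPair.gadget_min`, part 1), and the cheapest-matching valuation of a weighted bipartite graph is a
VALUATED MATROID on the rows (Murota): the basis exchange (…TropicalBBasisExchange) trades the gadget parts of `u a b'`, `u a' b` either for
matchings exposing `(a', b')` and `(a, b)` — excluded by supermodularity — or for two PHANTOM matchings exposing the same-register pairs
`{rI a, rI a'}` and `{rJ b, rJ b'}`, of total weight `VG a b' + VG a' b` (`alpha`); conversely any two such phantoms weigh at least that much
(`beta`, exchange again + dominance).  (3) Comparing the phantoms of the four minors `{0,1}×{0,2}`, `{0,1}×{1,2}`, `{0,2}×{0,2}`, `{0,2}×{1,2}`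
forces `VG 1 1 − VG 1 0 = VG 2 1 − VG 2 0`, against strict supermodularity on `{1,2}×{0,1}`.  The phantoms are NOT terms of the design (a
register never exposes two rows), so the law is invisible to the pairwise exchange law of the chain: located (seat exp/, lpreal oracle of
val-sym-trop-p1 g11) 230 sampled `3 × 3` families with an interior gadget row pass the pairwise law and are all LP-infeasible, while `2 × 2`
and `3 × 2` families are realisable.

[folklore: Murota, Discrete Convex Analysis (2003) §9 (valuated matroids induced by bipartite graphs; the 3-term exchange relation);
Dress–Wenzel 1992; the packaging as a no-go for dominance designs is the cell's]
-/

set_option linter.dupNamespace false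
set_option autoImplicit false

namespace Summit.ValiantsHypothesis.ValiantsHypothesis.Theorems.KPlusLogSqLaw

namespace RegisterPair

open Summit.ValiantsHypothesis.ValiantsHypothesis.Theorems.MatrixDescartes.Negative
open Summit.ValiantsHypothesis.ValiantsHypothesis.Theorems.LacunarySymmetroidMatrixDescartes
open Summit.ValiantsHypothesis.ValiantsHypothesis.Theorems.LacunarySymmetroidMatrixDescartes.TropicalCensus
open Summit.ValiantsHypothesis.ValiantsHypothesis.Theorems.KPlusLogSqLaw.MatchingExchange
open Literature.Computability.MetaComplexity.PBij
open scoped BigOperators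
open Finset

variable {m K : ℕ}

/-! ### The register-pair law -/

/-- **THE REGISTER-PAIR LAW** (no `3 × 3` product of dominant terms over two same-side registers read by one gadget).  See the module
docstring. [folklore: valuated-matroid exchange (Murota 2003 §9) + hull convexity; the packaging is the cell's] -/
theorem registerPair_law (d : Fin K → ℕ) (v ε : Fin m → Fin m → Fin K → ℤ)
    (G N : Finset (Fin m)) (l₀ : Fin K) (rI rJ : Fin 3 → Fin m)
    (u : Fin 3 → Fin 3 → Equiv.Perm (Fin m) × (Fin m → Fin K)) (θ : Fin 3 → Fin 3 → ℤ)
    (hdom : ∀ a b, IsDominant d v ε (θ a b) (u a b))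
    (hθI : ∀ a a' b, a < a' → θ a b < θ a' b) (hθJ : ∀ a b b', b < b' → θ a b < θ a b')
    (hcls : ∀ a b, ∀ g ∈ G, (u a b).2 g = l₀)
    (himg : ∀ a b, G.image (u a b).1 = insert (rI a) (insert (rJ b) N))
    (hIN : ∀ a, rI a ∉ N) (hJN : ∀ b, rJ b ∉ N) (hIJ : ∀ a b, rI a ≠ rJ b)
    (hI : Function.Injective rI) (hJ : Function.Injective rJ)
    (hout : ∀ c, c ∉ G →
      (∀ a b b', ((u a b).1 c, (u a b).2 c) = ((u a b').1 c, (u a b').2 c)) ∨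
      (∀ a a' b, ((u a b).1 c, (u a b).2 c) = ((u a' b).1 c, (u a' b).2 c))) :
    False := by
  classical
  -- presence of every cell of the family, in particular of the gadget cells at class `l₀`
  have hpresu : ∀ a b c, ε ((u a b).1 c) c ((u a b).2 c) ≠ 0 := fun a b => (termSign_ne_zero_iff ε _).1 (hdom a b).1
  have hpresG : ∀ a b, ∀ e ∈ G.image (fun g => ((u a b).1 g, g)), ε e.1 e.2 l₀ ≠ 0 := by
    intro a b e he
    obtain ⟨g, hg, rfl⟩ := Finset.mem_image.1 he
    have := hpresu a b g
    rwa [hcls a b g hg] at this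
  -- distinct indices give distinct terms (the exposed rows differ)
  have hN_sub : ∀ a b, N ⊆ G.image (u a b).1 := fun a b => by
    rw [himg]; exact (Finset.subset_insert _ _).trans (Finset.subset_insert _ _)
  have hneJ : ∀ a b b', b ≠ b' → u a b ≠ u a b' := by
    intro a b b' hbb h
    have h1 : rJ b ∈ G.image (u a b').1 := by rw [← h, himg]; simp
    rw [himg] at h1
    rcases Finset.mem_insert.1 h1 with h1 | h1
    · exact hIJ a b h1.symm
    · rcases Finset.mem_insert.1 h1 with h1 | h1
      · exact hbb (hJ h1)
      · exact hJN b h1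
  have hneI : ∀ a a' b, a ≠ a' → u a b ≠ u a' b := by
    intro a a' b haa h
    have h1 : rI a ∈ G.image (u a' b).1 := by rw [← h, himg]; simp
    rw [himg] at h1
    rcases Finset.mem_insert.1 h1 with h1 | h1
    · exact haa (hI h1)
    · rcases Finset.mem_insert.1 h1 with h1 | h1
      · exact hIJ a b h1
      · exact hIN a h1
  -- slopes increase with each index
  have hsJ : ∀ a b b', b < b' → slope d (u a b) < slope d (u a b') := fun a b b' h =>
    slope_lt_of_dominant d v ε (hθJ a b b' h) (hneJ a b b' (ne_of_lt h)) (hdom a b) (hdom a b')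
  have hsI : ∀ a a' b, a < a' → slope d (u a b) < slope d (u a' b) := fun a a' b h =>
    slope_lt_of_dominant d v ε (hθI a a' b h) (hneI a a' b (ne_of_lt h)) (hdom a b) (hdom a' b)
  -- gadget values and the split of the columnwise sums
  set VG : Fin 3 → Fin 3 → ℤ := fun a b => ∑ g ∈ G, v ((u a b).1 g) g l₀ with hVGdef
  have hsplit : ∀ f : Fin m → ℤ, ∑ i, f i = (∑ i ∈ G, f i) + ∑ i ∈ Gᶜ, f i :=
    fun f => (Finset.sum_add_sum_compl G f).symm
  -- modularity off the gadget: slopes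
  have hSmod : ∀ a a' b b', slope d (u a b) + slope d (u a' b') = slope d (u a b') + slope d (u a' b) := by
    intro a a' b b'
    unfold TropicalCensus.slope
    rw [← Finset.sum_add_distrib, ← Finset.sum_add_distrib]
    refine Finset.sum_congr rfl fun c _ => ?_
    by_cases hc : c ∈ G
    · rw [hcls a b c hc, hcls a' b' c hc, hcls a b' c hc, hcls a' b c hc]
    · rcases hout c hc with h | h
      · have e1 := congrArg (fun q : Fin m × Fin K => (d q.2 : ℤ)) (h a b b')
        have e2 := congrArg (fun q : Fin m × Fin K => (d q.2 : ℤ)) (h a' b b')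
        simp only at e1 e2
        linarith
      · have e1 := congrArg (fun q : Fin m × Fin K => (d q.2 : ℤ)) (h a a' b)
        have e2 := congrArg (fun q : Fin m × Fin K => (d q.2 : ℤ)) (h a a' b')
        simp only at e1 e2
        linarith
  -- modularity off the gadget: valuations, up to the gadget values
  have hVmod : ∀ a a' b b',
      (∑ i, v ((u a b).1 i) i ((u a b).2 i)) + (∑ i, v ((u a' b').1 i) i ((u a' b').2 i)) - VG a b - VG a' b' =
      (∑ i, v ((u a b').1 i) i ((u a b').2 i)) + (∑ i, v ((u a' b).1 i) i ((u a' b).2 i)) - VG a b' - VG a' b := by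
    intro a a' b b'
    have hG : ∀ x y, ∑ i ∈ G, v ((u x y).1 i) i ((u x y).2 i) = VG x y := fun x y =>
      Finset.sum_congr rfl fun g hg => by rw [hcls x y g hg]
    rw [hsplit (fun i => v ((u a b).1 i) i ((u a b).2 i)), hsplit (fun i => v ((u a' b').1 i) i ((u a' b').2 i)),
      hsplit (fun i => v ((u a b').1 i) i ((u a b').2 i)), hsplit (fun i => v ((u a' b).1 i) i ((u a' b).2 i)),
      hG, hG, hG, hG]
    have hC : (∑ i ∈ Gᶜ, v ((u a b).1 i) i ((u a b).2 i)) + ∑ i ∈ Gᶜ, v ((u a' b').1 i) i ((u a' b').2 i) =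
        (∑ i ∈ Gᶜ, v ((u a b').1 i) i ((u a b').2 i)) + ∑ i ∈ Gᶜ, v ((u a' b).1 i) i ((u a' b).2 i) := by
      rw [← Finset.sum_add_distrib, ← Finset.sum_add_distrib]
      refine Finset.sum_congr rfl fun c hc => ?_
      rw [Finset.mem_compl] at hc
      rcases hout c hc with h | h
      · have e1 := congrArg (fun q : Fin m × Fin K => v q.1 c q.2) (h a b b')
        have e2 := congrArg (fun q : Fin m × Fin K => v q.1 c q.2) (h a' b b')
        simp only at e1 e2
        linarith
      · have e1 := congrArg (fun q : Fin m × Fin K => v q.1 c q.2) (h a a' b)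
        have e2 := congrArg (fun q : Fin m × Fin K => v q.1 c q.2) (h a a' b')
        simp only at e1 e2
        linarith
    linarith
  -- (L1) strict supermodularity of the gadget values
  have L1 : ∀ a a' b b', a < a' → b < b' → VG a b' + VG a' b < VG a b + VG a' b' := by
    intro a a' b b' ha hb
    have hpar := parallelogram d v ε (hdom a b') (hdom a' b) (hdom a b).1 (hdom a' b').1 (hSmod a a' b b')
      (hsJ a b b' hb) (hsI a a' b ha)
    have := hVmod a a' b b'
    linarith
  -- the gadget parts as matchings
  have hM : ∀ a b, IsPMatching (G.image fun g => ((u a b).1 g, g)) := fun a b => isPMatching_gad _ _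
  have hMdom : ∀ a b, dom (G.image fun g => ((u a b).1 g, g)) = insert (rI a) (insert (rJ b) N) := fun a b => by
    rw [dom_gad, himg]
  have hMwt : ∀ a b, ∑ e ∈ G.image (fun g => ((u a b).1 g, g)), v e.1 e.2 l₀ = VG a b := fun a b =>
    wt_gad _ _ (fun x c => v x c l₀)
  -- gadget minimality in the form used below
  have hmin : ∀ a b (Y : Finset (Fin m × Fin m)), IsPMatching Y → rng Y = G →
      dom Y = insert (rI a) (insert (rJ b) N) → (∀ e ∈ Y, ε e.1 e.2 l₀ ≠ 0) → VG a b ≤ ∑ e ∈ Y, v e.1 e.2 l₀ :=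
    fun a b Y hY hr hd hp => gadget_min d v ε (hdom a b) G l₀ (hcls a b) hY hr ((himg a b).symm ▸ hd) hp
  -- (L3 = beta) any two phantoms weigh at least `VG a b' + VG a' b`
  have L3 : ∀ a a' b b', a < a' → b < b' → ∀ X Y : Finset (Fin m × Fin m), IsPMatching X → IsPMatching Y →
      rng X = G → rng Y = G → dom X = insert (rJ b) (insert (rJ b') N) → dom Y = insert (rI a) (insert (rI a') N) →
      (∀ e ∈ X, ε e.1 e.2 l₀ ≠ 0) → (∀ e ∈ Y, ε e.1 e.2 l₀ ≠ 0) →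
      VG a b' + VG a' b ≤ (∑ e ∈ X, v e.1 e.2 l₀) + ∑ e ∈ Y, v e.1 e.2 l₀ := by
    intro a a' b b' ha hb X Y hX hY hrX hrY hdX hdY hpX hpY
    have haa : rI a ≠ rI a' := fun h => (ne_of_lt ha) (hI h)
    have hbb : rJ b ≠ rJ b' := fun h => (ne_of_lt hb) (hJ h)
    have hcard : Y.card = X.card := by rw [← hY.card_rng, ← hX.card_rng, hrY, hrX]
    have hx : rI a ∈ dom Y := by rw [hdY]; simp
    have hx' : rI a ∉ dom X := by
      rw [hdX]; simp only [Finset.mem_insert, not_or]; exact ⟨hIJ a b, hIJ a b', hIN a⟩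
    obtain ⟨z, hz, hz', X'', Y'', hX'', hY'', hU, hInt, hrX'', hrY'', hdX'', hdY''⟩ :=
      basis_exchange hY hX hcard (hrY.trans hrX.symm) hx hx'
    have hwt := wt_add_eq hU hInt (fun e => v e.1 e.2 l₀)
    have hpres'' : ∀ e ∈ X'' ∪ Y'', ε e.1 e.2 l₀ ≠ 0 := by
      rw [hU]; intro e he
      rcases Finset.mem_union.1 he with he | he
      · exact hpY e he
      · exact hpX e he
    have hpX'' : ∀ e ∈ X'', ε e.1 e.2 l₀ ≠ 0 := fun e he => hpres'' e (Finset.mem_union_left _ he)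
    have hpY'' : ∀ e ∈ Y'', ε e.1 e.2 l₀ ≠ 0 := fun e he => hpres'' e (Finset.mem_union_right _ he)
    rw [hdY] at hdX''
    rw [hdX, Finset.mem_insert, Finset.mem_insert] at hz
    have hzN : z ∉ N := fun h => hz' (hdY ▸ Finset.mem_insert_of_mem (Finset.mem_insert_of_mem h))
    have hdX''' : dom X'' = insert z (insert (rI a') N) := by
      rw [hdX'', Finset.erase_insert]
      simp only [Finset.mem_insert, not_or]; exact ⟨haa, hIN a⟩
    rcases hz with hz | hz | hz
    · -- `z = rJ b`: the exchange exposes `(a', b)` and `(a, b')`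
      subst hz
      have h1 : VG a' b ≤ ∑ e ∈ X'', v e.1 e.2 l₀ :=
        hmin a' b X'' hX'' (hrX''.trans hrY) (by rw [hdX''', Finset.insert_comm]) hpX''
      have h2 : VG a b' ≤ ∑ e ∈ Y'', v e.1 e.2 l₀ :=
        hmin a b' Y'' hY'' (hrY''.trans hrY) (by rw [hdY'', hdX, Finset.erase_insert]; simp [hbb, hJN b]) hpY''
      linarith
    · -- `z = rJ b'`: the exchange exposes `(a', b')` and `(a, b)`
      subst hz
      have h1 : VG a' b' ≤ ∑ e ∈ X'', v e.1 e.2 l₀ :=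
        hmin a' b' X'' hX'' (hrX''.trans hrY) (by rw [hdX''', Finset.insert_comm]) hpX''
      have h2 : VG a b ≤ ∑ e ∈ Y'', v e.1 e.2 l₀ :=
        hmin a b Y'' hY'' (hrY''.trans hrY) (by rw [hdY'', hdX, erase_insert_insert hbb (hJN b')]) hpY''
      have := L1 a a' b b' ha hb
      linarith
    · exact absurd hz hzN
  -- (L2 = alpha) the phantoms exist, with total weight `VG a b' + VG a' b`
  have L2 : ∀ a a' b b', a < a' → b < b' → ∃ X Y : Finset (Fin m × Fin m), IsPMatching X ∧ IsPMatching Y ∧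
      rng X = G ∧ rng Y = G ∧ dom X = insert (rJ b) (insert (rJ b') N) ∧ dom Y = insert (rI a) (insert (rI a') N) ∧
      (∀ e ∈ X, ε e.1 e.2 l₀ ≠ 0) ∧ (∀ e ∈ Y, ε e.1 e.2 l₀ ≠ 0) ∧
      (∑ e ∈ X, v e.1 e.2 l₀) + ∑ e ∈ Y, v e.1 e.2 l₀ = VG a b' + VG a' b := by
    intro a a' b b' ha hb
    have haa : rI a ≠ rI a' := fun h => (ne_of_lt ha) (hI h)
    have hbb : rJ b ≠ rJ b' := fun h => (ne_of_lt hb) (hJ h)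
    set M := G.image fun g => ((u a b').1 g, g) with hMdef
    set M' := G.image fun g => ((u a' b).1 g, g) with hM'def
    have hcard : M.card = M'.card := by rw [card_gad, card_gad]
    have hx : rI a ∈ dom M := by rw [hMdom]; simp
    have hx' : rI a ∉ dom M' := by
      rw [hMdom]; simp only [Finset.mem_insert, not_or]; exact ⟨haa, hIJ a b, hIN a⟩
    obtain ⟨z, hz, hz', X, Y, hX, hY, hU, hInt, hrX, hrY, hdX, hdY⟩ :=
      basis_exchange (hM a b') (hM a' b) hcard (by rw [rng_gad, rng_gad]) hx hx'
    have hwt := wt_add_eq hU hInt (fun e => v e.1 e.2 l₀)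
    rw [hMwt, hMwt] at hwt
    have hpres'' : ∀ e ∈ X ∪ Y, ε e.1 e.2 l₀ ≠ 0 := by
      rw [hU]; intro e he
      rcases Finset.mem_union.1 he with he | he
      · exact hpresG a b' e he
      · exact hpresG a' b e he
    have hpX : ∀ e ∈ X, ε e.1 e.2 l₀ ≠ 0 := fun e he => hpres'' e (Finset.mem_union_left _ he)
    have hpY : ∀ e ∈ Y, ε e.1 e.2 l₀ ≠ 0 := fun e he => hpres'' e (Finset.mem_union_right _ he)
    have hrGX : rng X = G := by rw [hrX]; exact rng_gad _ _
    have hrGY : rng Y = G := by rw [hrY]; exact rng_gad _ _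
    rw [hMdom] at hdX hdY hz
    rw [hMdom] at hz'
    rw [Finset.mem_insert, Finset.mem_insert] at hz
    have hzN : z ∉ N := fun h => hz' (Finset.mem_insert_of_mem (Finset.mem_insert_of_mem h))
    have hdX' : dom X = insert z (insert (rJ b') N) := by
      rw [hdX, Finset.erase_insert]
      simp only [Finset.mem_insert, not_or]; exact ⟨hIJ a b', hIN a⟩
    rcases hz with hz | hz | hz
    · -- `z = rI a'`: the exchange exposes `(a', b')` and `(a, b)` — excluded by supermodularity
      subst hz
      have h1 : VG a' b' ≤ ∑ e ∈ X, v e.1 e.2 l₀ := hmin a' b' X hX hrGX hdX' hpX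
      have h2 : VG a b ≤ ∑ e ∈ Y, v e.1 e.2 l₀ :=
        hmin a b Y hY hrGY (by rw [hdY, Finset.erase_insert]; simp [hIJ a' b, hIN a']) hpY
      have := L1 a a' b b' ha hb
      exfalso; linarith
    · -- `z = rJ b`: the two phantoms
      subst hz
      refine ⟨X, Y, hX, hY, hrGX, hrGY, ?_, ?_, hpX, hpY, by linarith⟩
      · rw [hdX', Finset.insert_comm]
      · rw [hdY, erase_insert_insert (hIJ a' b) (hJN b), Finset.insert_comm]
    · exact absurd hz hzN
  -- (L4) the four minors
  have h01 : (0 : Fin 3) < 1 := by decide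
  have h02 : (0 : Fin 3) < 2 := by decide
  have h12 : (1 : Fin 3) < 2 := by decide
  obtain ⟨X1, Y1, hX1, hY1, rX1, rY1, dX1, dY1, pX1, pY1, w1⟩ := L2 0 1 0 2 h01 h02
  obtain ⟨X2, Y2, hX2, hY2, rX2, rY2, dX2, dY2, pX2, pY2, w2⟩ := L2 0 1 1 2 h01 h12
  obtain ⟨X3, Y3, hX3, hY3, rX3, rY3, dX3, dY3, pX3, pY3, w3⟩ := L2 0 2 0 2 h02 h02
  obtain ⟨X4, Y4, hX4, hY4, rX4, rY4, dX4, dY4, pX4, pY4, w4⟩ := L2 0 2 1 2 h02 h12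
  have b12 := L3 0 1 0 2 h01 h02 X1 Y2 hX1 hY2 rX1 rY2 dX1 dY2 pX1 pY2
  have b21 := L3 0 1 1 2 h01 h12 X2 Y1 hX2 hY1 rX2 rY1 dX2 dY1 pX2 pY1
  have b34 := L3 0 2 0 2 h02 h02 X3 Y4 hX3 hY4 rX3 rY4 dX3 dY4 pX3 pY4
  have b43 := L3 0 2 1 2 h02 h12 X4 Y3 hX4 hY3 rX4 rY3 dX4 dY3 pX4 pY3
  have b31 := L3 0 1 0 2 h01 h02 X3 Y1 hX3 hY1 rX3 rY1 dX3 dY1 pX3 pY1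
  have b13 := L3 0 2 0 2 h02 h02 X1 Y3 hX1 hY3 rX1 rY3 dX1 dY3 pX1 pY3
  have b42 := L3 0 1 1 2 h01 h12 X4 Y2 hX4 hY2 rX4 rY2 dX4 dY2 pX4 pY2
  have b24 := L3 0 2 1 2 h02 h12 X2 Y4 hX2 hY4 rX2 rY4 dX2 dY4 pX2 pY4
  have key := L1 1 2 0 1 h12 h01
  linarith

end RegisterPair

end Summit.ValiantsHypothesis.ValiantsHypothesis.Theorems.KPlusLogSqLaw
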